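import Mathlib.Data.Real.Basic
import Mathlib.Tactic.Linarith
import Mathlib.Tactic.Ring
import Mathlib.Tactic.FieldSimp
import Mathlib.Tactic.Positivity
import HarnessLib

/-!
# QUANT lane R8, T-DEC, leg (III), blob case — the thin regime of `MixLawCellPDear`: the LAST GLUE, (♦′) ⟹ (I_{U₁}), as a pure real lemma

builds on p205010 (kernel theorem, internal audit signed; external expert review pending)

Support file (`--supports stmt-CriticalPhenomena-4575`), QUANT lane lead seat prim-quant-lead (gen 33), rung R8 of
`run/shared/lean/prim/quant/LADDER.md`.  Memo: arm-2 g36 `…/prim-quant-arm-2-g36/THIN-REGIME-G36.md` §2; lead g33 HANDOFF GEN-33.  Pure real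
arithmetic, standard axioms, no sorries.

THE GLUE.  Atoms `0, k₁, ℓ, k₂, G` with masses `z, A, B, C, D` (only `D ≥ 0` and `k₁ ≥ 0` are used), total mass `1`, mean `t` (`k₁A + ℓB + k₂C + GD = t`); `p = t − 2k₁`,
`q = k₂ − t + k₁ > 0`, `r = t − ℓ`; the dear usage `U₁` with `U₁·q = p`; any real `U_d` (the shifted low's usage); the giant rate `u > 0` with
`u(G − t) ≤ t` (top-affordability `yG ≤ t`); the thin bound `D ≤ u(z + A)`.  THEN
  (♦′) `k₁(C − A) + (r − q·U_d)·B ≥ 0`  ⟹  (I_{U₁}) `U₁(z + A) + U_d·B ≤ C + U₁·D/u`.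
Proof: `q·[(I_{U₁}) slack] = 2k₁z + k₁A + k₁C + (r − qU_d)B − (G−t)D + pD/u` by the mean identity (this is arm-2's (♥) bookkeeping), and
`(G−t)D = u(G−t)·(D/u) ≤ t·(D/u) = 2k₁·(D/u) + p·(D/u) ≤ 2k₁(z+A) + pD/u`.  With (♦′) ⟸ C1 + `usage_twin_gap_lb` (`…ThinC1Glue`, `…TwinGapLB`)
and C1 ⟸ (C1′) + the derived bounds (`…ThinC1`, `…ThinBounds`, `…ThinDelta`), every scalar piece of the doubly-thin leaf is now kernel; what
remains is the ASSEMBLY inside `mixLawCellPDear_of_thinKink`'s ∀ (closed forms `usage_eq_heavy'`/`usage_eq_light'`, the heavy-ℓ and small-bracket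
sub-cases via `…A5Fill`, the degenerate corners a = 0 / k₁ = 0).

* **`LawDec.thin_IU1_of_diamond`**.

[this work]; the (♥) identity: arm-2 g36.  Nothing here is cited as a published result.
-/

namespace Summit.CriticalPhenomena.PercolationContinuityZ3.Theorems

namespace Quant

namespace LawDec

set_option maxHeartbeats 400000 in
/-- **(♦′) ⟹ (I_{U₁}) on the thin regime** (pure reals, `k₁ ≥ 0`; see the file header for the roles of the variables). [this work] -/
theorem thin_IU1_of_diamond (z A B C D u U₁ Ud t k₁ ℓ k₂ G : ℝ) (hk₁ : 0 ≤ k₁) (hD : 0 ≤ D)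
    (hmass : z + A + B + C + D = 1) (hmean : k₁ * A + ℓ * B + k₂ * C + G * D = t)
    (hq : 0 < k₂ - t + k₁) (hU₁ : U₁ * (k₂ - t + k₁) = t - 2 * k₁) (hu : 0 < u)
    (hTA : u * (G - t) ≤ t) (hthinD : D ≤ u * (z + A))
    (hdiamond : 0 ≤ k₁ * (C - A) + ((t - ℓ) - (k₂ - t + k₁) * Ud) * B) :
    U₁ * (z + A) + Ud * B ≤ C + U₁ * D / u := by
  set q : ℝ := k₂ - t + k₁ with hqdef
  have hune : u ≠ 0 := hu.ne'
  -- q · slack = 2k₁ z + k₁ A + k₁ C + B₁ B − (G − t) D + p D/u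
  have key : q * (C + U₁ * D / u - U₁ * (z + A) - Ud * B)
      = 2 * k₁ * z + k₁ * A + k₁ * C + ((t - ℓ) - q * Ud) * B - (G - t) * D + (t - 2 * k₁) * D / u := by
    have hmean' : (k₂ - t) * C = t * z + (t - k₁) * A + (t - ℓ) * B - (G - t) * D := by
      have : t * (z + A + B + C + D) = t := by rw [hmass]; ring
      linarith
    have e1 : q * (C + U₁ * D / u - U₁ * (z + A) - Ud * B)
        = (k₂ - t) * C + k₁ * C + (U₁ * q) * D / u - (U₁ * q) * (z + A) - q * Ud * B := by
      rw [hqdef]; field_simp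
    rw [e1, hU₁, hmean']; ring
  -- (G − t) D ≤ 2k₁ (z + A) + p D/u
  have hGD : (G - t) * D ≤ 2 * k₁ * (z + A) + (t - 2 * k₁) * D / u := by
    have h1 : (G - t) * D = (u * (G - t)) * (D / u) := by field_simp
    have hDu : 0 ≤ D / u := div_nonneg hD hu.le
    have h2 : (u * (G - t)) * (D / u) ≤ t * (D / u) := mul_le_mul_of_nonneg_right hTA hDu
    have h3 : D / u ≤ z + A := by rw [div_le_iff₀ hu]; linarith
    have hk : t * (D / u) = 2 * k₁ * (D / u) + (t - 2 * k₁) * D / u := by ring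
    have h4 : 2 * k₁ * (D / u) ≤ 2 * k₁ * (z + A) := mul_le_mul_of_nonneg_left h3 (by linarith)
    linarith
  have hslack : 0 ≤ q * (C + U₁ * D / u - U₁ * (z + A) - Ud * B) := by
    rw [key]
    nlinarith [hdiamond, hGD]
  have := (mul_nonneg_iff_of_pos_left hq).1 hslack
  linarith

end LawDec

end Quant

end Summit.CriticalPhenomena.PercolationContinuityZ3.Theorems
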